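import Literature.MathematicalPhysics.QuantumLattice.FermionicTreeExpansionDetBound
import HarnessLib

/-!
# Summing the determinant-bound tree estimate over the positions (single-scale `n!`-free estimate)

Twin of `FermionicTreeExpansionDecay.sum_norm_ursellOf_moment_le` for propagators WITHOUT Gram form:
there the truncated expectation of local clusters at positions `p x ∈ Λ` (a finite abelian group) was
summed over the positions with the root held fixed, for a propagator in Gram form with unit Gram
vectors; here the same is done under the determinant bound of `FermionicTreeExpansionDetBound.lean`
(closed tree form `‖𝓔ᵀ(W)‖ ≤ Σ_T δ^{|F_W|} ∏_{ℓ ∈ T} (2 n² M_ℓ)`), for a family of propagator matrices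
`G_p` indexed by the positions, with a position-uniform determinant bound `δ` and an even translation
invariant line bound `‖G_p f f'‖ ≤ γ(p(c f) - p(c f'))`:

* `fieldsOf_univ` — all field pairs belong to the clusters of `univ`;
* **`sum_norm_ursellOf_moment_le_of_detBound`** —
  `Σ_{p : p v = a} ‖𝓔ᵀ_p(ι)‖ ≤ |ι|^{|ι|-2} · δ^{|F|} · (2 n² Σ_z γ z)^{|ι|-1}`
  (Cayley's count of the anchored cluster trees, `2n²` field lines per cluster line, the `ℓ¹` norm of
  `γ` per tree line by the tree-decay lemma `Script.sum_lineWeightProd_eq_prod_sum`, and `δ^{|F|}` for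
  the last determinant) — Benfatto–Giuliani–Mastropietro 2006, the bound (2.77) at one scale with the
  determinant bound (2.80); Mastropietro 2008, §2.9–2.10; the form needed for the positive-temperature
  free fermion propagator (de Siqueira Pedra–Salmhofer 2008), see `PropMatrixTruncatedBound.lean`.

Everything is PROVED; no definition and no named fact.

## References
* G. Benfatto, A. Giuliani, V. Mastropietro, Ann. Henri Poincaré 7 (2006) 809–898, (2.66)–(2.77), (2.80).
  [cite: BenfattoGiulianiMastropietro2006, (2.66)-(2.77)]
* V. Mastropietro, *Non-Perturbative Renormalization* (2008), §2.9–2.10. [cite: Mastropietro2008, §2.10]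
* D. C. Brydges, *A short course on cluster expansions*, Les Houches 1984. [cite: Brydges1986]
-/

noncomputable section

open MvPolynomial Finsupp Matrix Finset Literature.RingTheory.MvPolynomial
open Literature.Probability.LatticeModels Literature.Probability.LatticeModels.BattleFederbush
open Literature.MeasureTheory.Integral Literature.Analysis.InnerProduct
open scoped InnerProductSpace

namespace Literature.MathematicalPhysics.QuantumLattice

namespace FermionicTree

variable {𝕜 : Type*} [RCLike 𝕜]
variable {ι : Type*} [DecidableEq ι] {F : Type*} [Fintype F] [LinearOrder F]
variable (c : F → ι)

omit [LinearOrder F] in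
/-- All field pairs belong to the clusters of `univ`. [folklore] -/
theorem fieldsOf_univ [Fintype ι] : fieldsOf c (univ : Finset ι) = univ := by
  ext a
  simp [mem_fieldsOf]

variable {Λ : Type*} [AddCommGroup Λ] [Fintype Λ] [DecidableEq Λ] [Fintype ι] {v : ι}

/-- **The single-scale `n!`-free estimate under a determinant bound**: for local clusters `x ∈ ι` at
positions `p x ∈ Λ` (a finite abelian group) and a family of propagator matrices `G_p` on the field
pairs whose Gram-weighted minors obey `‖det‖ ≤ δ^{size}` for every `p` (`δ ≥ 1`), with an even
translation invariant line bound `‖G_p f f'‖ ≤ γ(p(c f) - p(c f'))` and at most `n` field pairs per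
cluster,
`Σ_{p : p v = a} ‖𝓔ᵀ_p(ι)‖ ≤ |ι|^{|ι|-2} · δ^{|F|} · (2 n² Σ_z γ z)^{|ι|-1}`.
[cite: BenfattoGiulianiMastropietro2006, (2.66)-(2.77)] -/
theorem sum_norm_ursellOf_moment_le_of_detBound (Gp : (ι → Λ) → Matrix F F 𝕜) {δ : ℝ} (hδ : 1 ≤ δ)
    (hDB : ∀ (p : ι → Λ) (m r : ℕ) (w : Fin r → EuclideanSpace ℝ (Fin m)), (∀ a, ‖w a‖ = 1) →
      ∀ (e : Fin r ↪o F) (c' : ℕ) (ρ γ : Fin c' → Fin r), StrictMono ρ → StrictMono γ →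
        ‖(Matrix.of fun a b : Fin c' =>
            ((⟪w (ρ a), w (γ b)⟫_ℝ : ℝ) : 𝕜) * Gp p (e (ρ a)) (e (γ b))).det‖ ≤ δ ^ c')
    (γ : Λ → ℝ) (hγ0 : ∀ z, 0 ≤ γ z) (hγ : ∀ z, γ (-z) = γ z)
    (hG : ∀ p f f', ‖Gp p f f'‖ ≤ γ (p (c f) - p (c f')))
    (n : ℕ) (hn : ∀ x : ι, (fieldsOf c {x}).card ≤ n) (a : Λ) :
    ∑ p ∈ univ.filter (fun p : ι → Λ => p v = a), ‖ursellOf (moment c (Gp p)) univ‖ ≤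
      (Fintype.card ι : ℝ) ^ (Fintype.card ι - 2) *
        (δ ^ Fintype.card F * (2 * (n : ℝ) ^ 2 * ∑ z, γ z) ^ (Fintype.card ι - 1)) := by
  have hv : v ∈ (univ : Finset ι) := mem_univ v
  set Cst : ℝ := δ ^ Fintype.card F * (2 * (n : ℝ) ^ 2 * ∑ z, γ z) ^ (Fintype.card ι - 1) with hCst
  have hγ1 : 0 ≤ ∑ z, γ z := sum_nonneg fun z _ => hγ0 z
  have hδ0 : 0 ≤ δ := zero_le_one.trans hδ
  have hnF : ∀ x : ι, (univ.filter fun f : F => c f = x).card ≤ n := fun x => by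
    refine le_trans (le_of_eq ?_) (hn x)
    congr 1
    ext f
    simp [mem_fieldsOf]
  have hcardF : (fieldsOf c (univ : Finset ι)).card = Fintype.card F := by
    rw [fieldsOf_univ, card_univ]
  -- Step 1: the tree-form bound at every position, and exchange of the sums
  have step1 : ∀ p : ι → Λ, ‖ursellOf (moment c (Gp p)) univ‖ ≤
      ∑ T ∈ lineSets v (univ : Finset ι), δ ^ Fintype.card F *
        ∏ ℓ ∈ T, (2 * (n : ℝ) ^ 2 * lineWeight γ hγ p ℓ) := fun p => by
    rw [← hcardF]
    exact norm_ursellOf_moment_le_sum_lineSets_of_detBound c (Gp p) hδ (hDB p) hnF (lineWeight γ hγ p)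
      (fun ℓ => Sym2.inductionOn ℓ fun u w => by rw [lineWeight_mk]; exact hγ0 _)
      (fun f f' => by rw [lineWeight_mk]; exact hG p f f') univ hv
  refine (sum_le_sum fun p _ => step1 p).trans ?_
  rw [Finset.sum_comm]
  -- Step 2: each anchored cluster tree contributes at most `Cst`
  have step2 : ∀ T ∈ lineSets v (univ : Finset ι),
      ∑ p ∈ univ.filter (fun p : ι → Λ => p v = a), δ ^ Fintype.card F *
        ∏ ℓ ∈ T, (2 * (n : ℝ) ^ 2 * lineWeight γ hγ p ℓ) ≤ Cst := by
    intro T hT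
    obtain ⟨k, -, s, hs, huniv, rfl⟩ := mem_lineSets.1 hT
    have hk : k + 1 = Fintype.card ι := by
      rw [← Script.card_image_y s hs, huniv, card_univ]
    have hlen : s.lines.length = Fintype.card ι - 1 := by rw [Script.length_lines]; omega
    -- the closed tree bound of `T = lines(s)` at position `p` is `δ^{|F|} (2n²)^k ∏_ℓ γ(...)`
    have hbound : ∀ p : ι → Λ,
        δ ^ Fintype.card F * ∏ ℓ ∈ s.lines.toFinset, (2 * (n : ℝ) ^ 2 * lineWeight γ hγ p ℓ) =
          δ ^ Fintype.card F * ((2 * (n : ℝ) ^ 2) ^ (Fintype.card ι - 1) *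
            s.lineWeightProd (fun _ => γ) (p ∘ s.y)) := by
      intro p
      rw [List.prod_toFinset _ (Script.nodup_lines s hs), prod_map_const_mul, hlen,
        prod_map_lines_eq_lineWeightProd γ hγ p s]
    calc ∑ p ∈ univ.filter (fun p : ι → Λ => p v = a), δ ^ Fintype.card F *
          ∏ ℓ ∈ s.lines.toFinset, (2 * (n : ℝ) ^ 2 * lineWeight γ hγ p ℓ)
        = ∑ p ∈ univ.filter (fun p : ι → Λ => p v = a), δ ^ Fintype.card F *
            ((2 * (n : ℝ) ^ 2) ^ (Fintype.card ι - 1) * s.lineWeightProd (fun _ => γ) (p ∘ s.y)) :=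
          sum_congr rfl fun p _ => hbound p
      _ = δ ^ Fintype.card F * ((2 * (n : ℝ) ^ 2) ^ (Fintype.card ι - 1) * (∑ z, γ z) ^ k) := by
          rw [← Finset.mul_sum, ← Finset.mul_sum, sum_lineWeightProd_comp_eq_pow s hs huniv γ a]
      _ ≤ Cst := le_of_eq (by rw [hCst, show k = Fintype.card ι - 1 by omega, ← mul_pow])
  -- Step 3: Cayley
  calc ∑ T ∈ lineSets v (univ : Finset ι), ∑ p ∈ univ.filter (fun p : ι → Λ => p v = a),
        δ ^ Fintype.card F * ∏ ℓ ∈ T, (2 * (n : ℝ) ^ 2 * lineWeight γ hγ p ℓ)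
      ≤ ∑ _T ∈ lineSets v (univ : Finset ι), Cst := sum_le_sum step2
    _ = (lineSets v (univ : Finset ι)).card * Cst := by rw [sum_const, nsmul_eq_mul]
    _ ≤ (Fintype.card ι : ℝ) ^ (Fintype.card ι - 2) * Cst := by
        refine mul_le_mul_of_nonneg_right ?_ (by positivity)
        have h := card_lineSets_le_pow hv
        rw [card_univ] at h
        exact_mod_cast h

end FermionicTree

end Literature.MathematicalPhysics.QuantumLattice
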